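import Summits.QuantumFields.YangMills.Theorems.NotChatterjeeMassGapProblem
import Literature.MathematicalPhysics.QuantumFieldTheory.Sweep1ShenZhuZhuProofs
import Literature.MathematicalPhysics.QuantumFieldTheory.TorusFreeTransfer
import Literature.MathematicalPhysics.QuantumFieldTheory.FiniteGaugeGroupTorus
import HarnessLib

/-!
# LINE L2 (ym-idea-4 g5) — the DICTIONARY, part 1: Sweep1's free-boundary cube states for a finite
gauge group are finite Gibbs ratios over the cube's links; Adhikari–Cao's cube, unit-square
rectangles and plaquette loops read in Sweep1's `ℤ⁴` vocabulary

Everything here is fully proved; no new definitions, no new axioms.  Part 2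
(`NotChatterjeeMassGapBoxDecay`) applies Adhikari–Cao's Theorem 1.1 and concludes
`correlationDecay → ¬ ChatterjeeMassGapProblem`.
-/

noncomputable section

open MeasureTheory ProbabilityTheory Filter Topology
open Literature.MathematicalPhysics.QuantumFieldTheory
open Literature.MathematicalPhysics.QuantumFieldTheory.AdhikariCao2022
open Literature.Probability.LatticeModels (box mem_box glueWith glueWith_apply_mem
  glueWith_apply_not_mem)

namespace Summit.QuantumFields.YangMills.Theorems.NotChatterjeeMassGap

/-! ### Cylinder functions: `dg_∞`-integrals and free-boundary expectations are finite-dimensional -/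

section Cylinder

variable {d N : ℕ} {G : Type*} [Group G] [TopologicalSpace G] [IsTopologicalGroup G]
  [CompactSpace G] [MeasurableSpace G] [BorelSpace G]

/-- The `dg_∞`-integral of a bounded measurable function depending only on the links in a finite
set `E` is its integral over `G^E` (product Haar), the other links frozen to `1`. [folklore] -/
theorem integral_zdHaar_eq_integral_pi_of_dependsOn (E : Finset (ZdEdge d))
    {Φ : ZdGaugeConfig d G → ℝ} (hΦm : Measurable Φ) {C : ℝ} (hC : ∀ U, |Φ U| ≤ C)
    (hdep : DependsOn Φ (E : Set (ZdEdge d))) :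
    ∫ U, Φ U ∂(zdHaar d G) =
      ∫ ζ, Φ (glueWith E ζ 1) ∂(Measure.pi fun _ : ↥E => haarProbability G) := by
  rw [integral_zdHaar_eq_integral_integral_glueWith E hΦm hC]
  have h : ∀ η : ZdGaugeConfig d G,
      (∫ ζ, Φ (glueWith E ζ η) ∂(Measure.pi fun _ : ↥E => haarProbability G)) =
        ∫ ζ, Φ (glueWith E ζ 1) ∂(Measure.pi fun _ : ↥E => haarProbability G) := by
    intro η
    refine integral_congr_ae (ae_of_all _ fun ζ => ?_)
    exact hdep fun e he => by
      rw [glueWith_apply_mem _ _ _ (Finset.mem_coe.1 he), glueWith_apply_mem _ _ _ (Finset.mem_coe.1 he)]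
  simp_rw [h]
  simp [integral_const]

variable [SecondCountableTopology G]

/-- **Free-boundary expectations of cylinder observables are finite-dimensional Gibbs ratios**:
if `E ⊇` the bonds of the plaquettes of `Λ` and `F` is continuous and depends only on the links in
`E`, then `⟨F⟩_{Λ,β} = ∫_{G^E} F e^{-β S_Λ} / ∫_{G^E} e^{-β S_Λ}` (links off `E` frozen to `1`).
[cite: OsterwalderSeiler1978, §2.1] -/
theorem zdExpect_eq_div_integral_pi (ρ : G →* Matrix (Fin N) (Fin N) ℂ) (hρ : Continuous ρ) (β : ℝ)
    (Λ : Finset (Literature.Probability.LatticeModels.Site d)) (E : Finset (ZdEdge d))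
    (hE : (plaquettesIn Λ).biUnion Plaq.bonds ⊆ E) {F : ZdGaugeConfig d G → ℝ}
    (hFc : Continuous F) (hFdep : DependsOn F (E : Set (ZdEdge d))) :
    zdExpect ρ β Λ F =
      (∫ ζ, F (glueWith E ζ 1) * Real.exp (-β * zdWilsonAction ρ Λ (glueWith E ζ 1))
          ∂(Measure.pi fun _ : ↥E => haarProbability G)) /
        ∫ ζ, Real.exp (-β * zdWilsonAction ρ Λ (glueWith E ζ 1))
          ∂(Measure.pi fun _ : ↥E => haarProbability G) := by
  obtain ⟨C, hC⟩ := Literature.MathematicalPhysics.QuantumLattice.exists_bound_of_continuous hFc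
  have hwc : Continuous fun U : ZdGaugeConfig d G => Real.exp (-β * zdWilsonAction ρ Λ U) :=
    Real.continuous_exp.comp (continuous_const.mul (AreaLaw.continuous_zdWilsonAction ρ hρ _))
  obtain ⟨Cw, hCw⟩ := Literature.MathematicalPhysics.QuantumLattice.exists_bound_of_continuous hwc
  have hsub : ∀ e, e ∈ (((plaquettesIn Λ).biUnion Plaq.bonds : Finset (ZdEdge d)) : Set (ZdEdge d)) →
      e ∈ (E : Set (ZdEdge d)) := fun e he => Finset.mem_coe.2 (hE (Finset.mem_coe.1 he))
  have hdepw : DependsOn (fun U : ZdGaugeConfig d G => Real.exp (-β * zdWilsonAction ρ Λ U))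
      (E : Set (ZdEdge d)) := by
    intro U V h
    simp only
    rw [dependsOn_zdWilsonAction ρ Λ fun e he => h e (hsub e he)]
  have hdepFw : DependsOn (fun U : ZdGaugeConfig d G => F U * Real.exp (-β * zdWilsonAction ρ Λ U))
      (E : Set (ZdEdge d)) := by
    intro U V h
    simp only
    rw [hFdep fun e he => h e he, dependsOn_zdWilsonAction ρ Λ fun e he => h e (hsub e he)]
  have hCFw : ∀ U, |F U * Real.exp (-β * zdWilsonAction ρ Λ U)| ≤ C * Cw := fun U => by
    rw [abs_mul]
    exact mul_le_mul (hC U) (hCw U) (abs_nonneg _) ((abs_nonneg _).trans (hC U))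
  rw [AreaLaw.zdExpect_eq_div_integral ρ hρ,
    integral_zdHaar_eq_integral_pi_of_dependsOn E
      (Φ := fun U => F U * Real.exp (-β * zdWilsonAction ρ Λ U)) (hFc.mul hwc).measurable hCFw hdepFw,
    integral_zdHaar_eq_integral_pi_of_dependsOn E hwc.measurable hCw hdepw]

end Cylinder

/-! ### Finite gauge groups: the finite-dimensional integrals are finite averages -/

section FiniteGroup

variable {d N : ℕ} {G : Type*} [Group G] [Fintype G] [TopologicalSpace G] [DiscreteTopology G]
  [IsTopologicalGroup G] [MeasurableSpace G] [BorelSpace G]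

omit [Group G] [IsTopologicalGroup G] in
/-- Over a finite gauge group the product Haar integral on `G^E` is the uniform average.
[folklore] -/
theorem integral_pi_haarProbability_eq_sum [Group G] [IsTopologicalGroup G] (E : Finset (ZdEdge d))
    (f : (↥E → G) → ℝ) :
    ∫ ζ, f ζ ∂(Measure.pi fun _ : ↥E => haarProbability G) =
      ((Fintype.card G : ℝ)⁻¹) ^ Fintype.card ↥E * ∑ ζ : ↥E → G, f ζ := by
  classical
  haveI : DiscreteMeasurableSpace G := discreteMeasurableSpace_of_borel
  have hζ : ∀ ζ : ↥E → G, (Measure.pi fun _ : ↥E => haarProbability G) {ζ} =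
      ((Fintype.card G : ENNReal)⁻¹) ^ Fintype.card ↥E := by
    intro ζ
    rw [← Set.univ_pi_singleton ζ, Measure.pi_pi]
    simp only [haarProbability_singleton, Finset.prod_const, Finset.card_univ]
  rw [integral_fintype Integrable.of_finite, Finset.mul_sum]
  refine Finset.sum_congr rfl fun ζ _ => ?_
  rw [measureReal_def, hζ, ENNReal.toReal_pow, ENNReal.toReal_inv, ENNReal.toReal_natCast,
    smul_eq_mul]

/-- **Free-boundary expectations over a finite gauge group are finite Gibbs averages** over the
link variables in `E`: `⟨F⟩_{Λ,β} = (∑_ζ F(ζ) e^{-β S_Λ(ζ)}) / ∑_ζ e^{-β S_Λ(ζ)}`, `ζ ∈ G^E`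
extended by `1`. [cite: SeilerLNP1982, Ch. 1] -/
theorem zdExpect_eq_sum_div_sum (ρ : G →* Matrix (Fin N) (Fin N) ℂ) (β : ℝ)
    (Λ : Finset (Literature.Probability.LatticeModels.Site d)) (E : Finset (ZdEdge d))
    (hE : (plaquettesIn Λ).biUnion Plaq.bonds ⊆ E) {F : ZdGaugeConfig d G → ℝ}
    (hFc : Continuous F) (hFdep : DependsOn F (E : Set (ZdEdge d))) :
    zdExpect ρ β Λ F =
      (∑ ζ : ↥E → G, F (glueWith E ζ 1) * Real.exp (-β * zdWilsonAction ρ Λ (glueWith E ζ 1))) /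
        ∑ ζ : ↥E → G, Real.exp (-β * zdWilsonAction ρ Λ (glueWith E ζ 1)) := by
  classical
  have hρ : Continuous ρ := continuous_of_discreteTopology
  rw [zdExpect_eq_div_integral_pi ρ hρ β Λ E hE hFc hFdep, integral_pi_haarProbability_eq_sum,
    integral_pi_haarProbability_eq_sum]
  have hc : ((Fintype.card G : ℝ)⁻¹) ^ Fintype.card ↥E ≠ 0 :=
    pow_ne_zero _ (inv_ne_zero (by exact_mod_cast Fintype.card_ne_zero))
  rw [mul_div_mul_left _ _ hc]

end FiniteGroup

/-! ### The cube `box 4 L` in Adhikari–Cao's vocabulary -/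

section CubeDictionary

/-- Adhikari–Cao's cube with lower corner `(-L,…,-L)` and side `2L` has vertex set `box 4 L`.
[cite: AdhikariCao2025, §1.2] -/
theorem cube_vertices_eq_box (L : ℕ) :
    ({ lower := fun _ => -(L : ℤ), side := 2 * L } : Cube).vertices = box 4 L := by
  ext x
  simp only [Cube.vertices, Fintype.mem_piFinset, Finset.mem_Icc, mem_box]
  refine forall_congr' fun i => ?_
  push_cast
  constructor
  · rintro ⟨h1, h2⟩; exact ⟨h1, by linarith⟩
  · rintro ⟨h1, h2⟩; exact ⟨h1, by linarith⟩

/-- Its plaquettes are Sweep1's `plaquettesIn (box 4 L)`. [cite: AdhikariCao2025, §1.2] -/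
theorem cube_plaquettes_eq (L : ℕ) :
    ({ lower := fun _ => -(L : ℤ), side := 2 * L } : Cube).plaquettes = plaquettesIn (box 4 L) := by
  ext p
  simp only [Cube.plaquettes, plaquettesIn, cube_vertices_eq_box, Finset.mem_filter,
    Finset.mem_product, Finset.mem_univ, and_true, unitVec]

/-- Its edges: pairs `(x, i)` with `x, x + eᵢ ∈ box 4 L`. [cite: AdhikariCao2025, §1.2] -/
theorem mem_cube_edges {L : ℕ} {e : ZdEdge 4} :
    e ∈ ({ lower := fun _ => -(L : ℤ), side := 2 * L } : Cube).edges ↔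
      e.1 ∈ box 4 L ∧ e.1 + Pi.single e.2 1 ∈ box 4 L := by
  simp only [Cube.edges, cube_vertices_eq_box, Finset.mem_filter, Finset.mem_product,
    Finset.mem_univ, and_true, unitVec]

/-- The bonds of the plaquettes of `box 4 L` are edges of the cube. [cite: AdhikariCao2025, §1.2] -/
theorem biUnion_bonds_subset_cube_edges (L : ℕ) :
    (plaquettesIn (box 4 L)).biUnion Plaq.bonds ⊆
      ({ lower := fun _ => -(L : ℤ), side := 2 * L } : Cube).edges := by
  intro e he
  obtain ⟨p, hp, hep⟩ := Finset.mem_biUnion.1 he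
  rw [Plaq.mem_plaquettesIn] at hp
  obtain ⟨h1, -, h2, h3, h4⟩ := hp
  rw [mem_cube_edges]
  simp only [Plaq.bonds, Finset.mem_insert, Finset.mem_singleton] at hep
  rcases hep with rfl | rfl | rfl | rfl
  · exact ⟨h1, h2⟩
  · exact ⟨h2, h4⟩
  · refine ⟨h3, ?_⟩; rwa [add_right_comm]
  · exact ⟨h1, h3⟩

variable {G : Type*} [Group G]

/-- The glued configuration `ζ 1_{Eᶜ}` on the cube's edge set is Adhikari–Cao's extension-by-`1`
`edgeVal ζ`. [cite: AdhikariCao2025, §1.2] -/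
theorem glueWith_edges_one_apply {Λ : Cube} (ζ : EdgeConfig Λ G) (e : ZdEdge 4) :
    glueWith Λ.edges ζ (1 : ZdGaugeConfig 4 G) e = edgeVal ζ e.1 e.2 := by
  unfold edgeVal
  by_cases h : (e.1, e.2) ∈ Λ.edges
  · rw [dif_pos h, glueWith_apply_mem _ _ _ h]
  · rw [dif_neg h, glueWith_apply_not_mem _ _ _ h]; rfl

/-- Sweep1's plaquette holonomy of the glued configuration is Adhikari–Cao's plaquette variable
(1.1) (same corner, same orientation). [cite: AdhikariCao2025, §1.2 eq. (1.1)] -/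
theorem plaquette_glueWith_edges_one {Λ : Cube} (ζ : EdgeConfig Λ G)
    (x : Literature.Probability.LatticeModels.Site 4) (i j : Fin 4) :
    ZdGaugeConfig.plaquette (glueWith Λ.edges ζ (1 : ZdGaugeConfig 4 G)) x i j =
      plaqHolonomy ζ (x, i, j) := by
  simp only [ZdGaugeConfig.plaquette, plaqHolonomy, glueWith_edges_one_apply, unitVec]

/-- Sweep1's free-boundary Wilson action of `box 4 L` at the glued configuration is Adhikari–Cao's
action (1.2) of the cube. [cite: AdhikariCao2025, §1.2 eq. (1.2)] -/
theorem zdWilsonAction_glueWith_eq_action {N : ℕ} (ρ : G →* Matrix (Fin N) (Fin N) ℂ) (L : ℕ)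
    (ζ : EdgeConfig ({ lower := fun _ => -(L : ℤ), side := 2 * L } : Cube) G) :
    zdWilsonAction ρ (box 4 L)
        (glueWith ({ lower := fun _ => -(L : ℤ), side := 2 * L } : Cube).edges ζ
          (1 : ZdGaugeConfig 4 G)) = action ρ ζ := by
  unfold zdWilsonAction action
  rw [cube_plaquettes_eq]
  refine Finset.sum_congr rfl fun p _ => ?_
  rw [plaquette_glueWith_edges_one, character, character, map_one, Matrix.trace_one,
    Fintype.card_fin, Complex.sub_re, Complex.natCast_re]

/-- The plaquette observable at the glued configuration. [cite: AdhikariCao2025, §1.2] -/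
theorem zdPlaquetteObs_glueWith_edges_one {N : ℕ} (ρ : G →* Matrix (Fin N) (Fin N) ℂ) {Λ : Cube}
    (ζ : EdgeConfig Λ G) (x : Literature.Probability.LatticeModels.Site 4) (i j : Fin 4) :
    zdPlaquetteObs ρ x i j (glueWith Λ.edges ζ (1 : ZdGaugeConfig 4 G)) =
      (N : ℝ)⁻¹ * (ρ (plaqHolonomy ζ (x, i, j))).trace.re := by
  rw [zdPlaquetteObs, plaquette_glueWith_edges_one]

end CubeDictionary

/-! ### Unit squares as Adhikari–Cao rectangles, their plaquette loops -/

section Geometry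

/-- Vertices of the unit square `[a, a + e₀ + e₁]`. [cite: AdhikariCao2025, §1.2] -/
theorem mem_unitSquare_vertices {a z : AdhikariCao2022.Site} :
    z ∈ ({ lo := a, hi := a + Pi.single 0 1 + Pi.single 1 1 } : Rectangle).vertices ↔
      ∀ k, a k ≤ z k ∧ z k ≤ a k + (Pi.single (0 : Fin 4) (1 : ℤ) : AdhikariCao2022.Site) k +
        (Pi.single (1 : Fin 4) (1 : ℤ) : AdhikariCao2022.Site) k := by
  simp [Rectangle.vertices, Fintype.mem_piFinset]

/-- The unit square is a non-degenerate rectangle. [cite: AdhikariCao2025, §1.2] -/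
theorem unitSquare_lo_le_hi (a : AdhikariCao2022.Site) :
    a ≤ a + Pi.single (0 : Fin 4) (1 : ℤ) + Pi.single 1 1 := by
  intro k
  fin_cases k <;> simp

/-- A unit square one step inside the cube lies in `box 4 L`. [cite: AdhikariCao2025, §1.2] -/
theorem unitSquare_vertices_subset_box {a : AdhikariCao2022.Site} {L : ℕ}
    (ha : ∀ k, -(L : ℤ) ≤ a k ∧ a k + 1 ≤ L) :
    ({ lo := a, hi := a + Pi.single 0 1 + Pi.single 1 1 } : Rectangle).vertices ⊆ box 4 L := by
  intro z hz
  rw [mem_unitSquare_vertices] at hz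
  rw [mem_box]
  intro k
  have h1 := hz k
  have h2 := ha k
  have h3 : (Pi.single (0 : Fin 4) (1 : ℤ) : AdhikariCao2022.Site) k +
      (Pi.single (1 : Fin 4) (1 : ℤ) : AdhikariCao2022.Site) k ≤ 1 := by
    fin_cases k <;> simp
  constructor <;> linarith

/-- The unit square at `a` is a plaquette of `box 4 L`. [folklore] -/
theorem unitSquare_mem_plaquettesIn {a : AdhikariCao2022.Site} {L : ℕ}
    (ha : ∀ k, -(L : ℤ) ≤ a k ∧ a k + 1 ≤ L) :
    ((a, (0 : Fin 4), (1 : Fin 4)) : Plaq 4) ∈ plaquettesIn (box 4 L) := by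
  rw [Plaq.mem_plaquettesIn]
  have h0 := ha 0; have h1 := ha 1; have h2 := ha 2; have h3 := ha 3
  simp only [mem_box]
  refine ⟨fun k => ?_, by decide, fun k => ?_, fun k => ?_, fun k => ?_⟩ <;>
    fin_cases k <;> simp <;> omega

/-- **The unit square contains exactly one plaquette**: `|B| = 1`. [cite: AdhikariCao2025, §1.2] -/
theorem unitSquare_plaqCount (a : AdhikariCao2022.Site) :
    ({ lo := a, hi := a + Pi.single 0 1 + Pi.single 1 1 } : Rectangle).plaqCount = 1 := by
  classical
  unfold Rectangle.plaqCount
  rw [Finset.card_eq_one]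
  refine ⟨(a, 0, 1), ?_⟩
  ext ⟨x, i, j⟩
  simp only [Finset.mem_filter, Finset.mem_product, Finset.mem_univ, and_true,
    Finset.mem_singleton, Prod.mk.injEq, mem_unitSquare_vertices, unitVec]
  constructor
  · rintro ⟨hx, hij, hxi, hxj, -⟩
    have hx0 := hx 0; have hx1 := hx 1; have hx2 := hx 2; have hx3 := hx 3
    have hxi' := hxi i
    have hxj' := hxj j
    fin_cases i <;> fin_cases j <;>
      simp -failIfUnchanged at hij hxi' hxj' hx0 hx1 hx2 hx3 ⊢ <;>
      first
        | omega
        | (funext k; fin_cases k <;> simp <;> omega)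
  · rintro ⟨rfl, rfl, rfl⟩
    refine ⟨fun k => ?_, by decide, fun k => ?_, fun k => ?_, fun k => ?_⟩ <;>
      fin_cases k <;> simp

/-- The `ℓ^∞` distance between the unit squares at `0` and at `n e₀` is at least `n - 1`.
[cite: AdhikariCao2025, Thm. 1.1] -/
theorem le_linfDist_unitSquares (n : ℕ) :
    ∀ x ∈ ({ lo := (0 : AdhikariCao2022.Site), hi := 0 + Pi.single 0 1 + Pi.single 1 1 } :
        Rectangle).vertices,
      ∀ y ∈ ({ lo := (Pi.single (0 : Fin 4) (n : ℤ) : AdhikariCao2022.Site)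
               hi := Pi.single (0 : Fin 4) (n : ℤ) + Pi.single 0 1 + Pi.single 1 1 } :
          Rectangle).vertices,
        (n : ℝ) - 1 ≤ linfDist x y := by
  intro x hx y hy
  rw [mem_unitSquare_vertices] at hx hy
  have hx0 := (hx 0).2
  have hy0 := (hy 0).1
  simp at hx0 hy0
  unfold linfDist
  have h1 : ‖((x 0 - y 0 : ℤ) : ℝ)‖ ≤ ‖fun i : Fin 4 => ((x i - y i : ℤ) : ℝ)‖ :=
    norm_le_pi_norm (fun i : Fin 4 => ((x i - y i : ℤ) : ℝ)) 0
  rw [Real.norm_eq_abs] at h1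
  have hx0' : ((x 0 : ℤ) : ℝ) ≤ 1 := by exact_mod_cast hx0
  have hy0' : (n : ℝ) ≤ ((y 0 : ℤ) : ℝ) := by exact_mod_cast hy0
  have h2 : (n : ℝ) - 1 ≤ |((x 0 - y 0 : ℤ) : ℝ)| := by
    push_cast
    rw [abs_sub_comm]
    linarith [le_abs_self (((y 0 : ℤ) : ℝ) - ((x 0 : ℤ) : ℝ))]
  linarith

variable {G : Type*} [Group G]

/-- **The plaquette loop.** The boundary of the unit square at `a` in the `(0,1)`-plane, traversed
`a → a + e₀ → a + e₀ + e₁ → a + e₁ → a`, is a closed loop contained in the square whose holonomy is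
the plaquette variable `σ_p`, `p = (a, 0, 1)`. [cite: AdhikariCao2025, §1.2 eq. (1.1)] -/
theorem exists_plaquetteLoop (Λ : Cube) (a : AdhikariCao2022.Site) :
    ∃ γ : ClosedLoop,
      γ.ContainedIn ({ lo := a, hi := a + Pi.single 0 1 + Pi.single 1 1 } : Rectangle).vertices ∧
        ∀ σ : EdgeConfig Λ G, holonomy σ γ = plaqHolonomy σ (a, 0, 1) := by
  refine ⟨{ len := 4
            edge := ![⟨a, 0, true⟩, ⟨a + Pi.single 0 1, 1, true⟩, ⟨a + Pi.single 1 1, 0, false⟩,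
              ⟨a, 1, false⟩]
            len_pos := by norm_num
            linked := ?_ }, ?_, ?_⟩
  · intro k
    fin_cases k <;>
      simp [OrientedEdge.source, OrientedEdge.target, unitVec, add_right_comm]
  · intro k
    fin_cases k <;>
      simp only [OrientedEdge.source, OrientedEdge.target, unitVec, mem_unitSquare_vertices] <;>
      simp <;> refine ⟨fun m => ?_, fun m => ?_⟩ <;> fin_cases m <;> simp
  · intro σ
    simp [holonomy, plaqHolonomy, orientedEdgeVal, List.ofFn_succ, unitVec, mul_assoc]

end Geometry

end Summit.QuantumFields.YangMills.Theorems.NotChatterjeeMassGap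

end
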